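import Literature.NumberTheory.LFunctions.MoebiusWalshCircuits
import Literature.NumberTheory.Sieve.MoebiusWalshCircuitsProofs
import Literature.NumberTheory.Sieve.MoebiusExpSum
import HarnessLib

/-!
# Möbius–Walsh sums: the combinatorial (Vaughan) reduction to type-I/II dyadic box sums — proved

Topic `Literature/NumberTheory/LFunctions`, proofs companion of `MoebiusWalshCircuits.lean`
(named fact `bourgain_moebius_walsh_uniform`, J. Bourgain, *Möbius–Walsh correlation bounds and an
estimate of Mauduit and Rivat*, J. Anal. Math. 119 (2013) 147–163 = arXiv:1109.2784, Theorem 1).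
Everything here is PROVED (theorems, plus six elementary `def`s with bodies: `natWalsh`, `dyBlock`,
`boxSum` and the three coefficient sequences `typeICoeff`, `typeIICoeffA`, `typeIICoeffB`).

This file is the TOP combinatorial layer of the printed proof for the MÖBIUS function: Bourgain,
§3, first sentence ("We use Lemma 1 from [M-R] …", i.e. the Vaughan-type reduction of
`∑_{n<X} μ(n) f(n)` to type-I and type-II sums, Mauduit–Rivat, Ann. of Math. 171 (2010), Lemme 1,
there printed for `Λ`), made precise for `μ` and for the Walsh weights `f = w_S · 𝟙_{[1, 2ⁿ)}`:

* `natWalsh T m = ∏_{j ∈ T} (−1)^{bit_j(m)}` (`T : Finset ℕ`), the `2^{max T + 1}`-periodic Walsh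
  character read on natural numbers; `walshSum g A = ∑_{1 ≤ m < 2ⁿ} g(m) natWalsh (A.map val) m`
  (`walshSum_eq_sum_Ico_natWalsh`).
* The sharp cutoff is itself a Walsh character one digit up: for `m < 2^{n+1}`,
  `𝟙_{m < 2ⁿ} = (1 + (−1)^{bit_n(m)})/2`, so `w_S(m)𝟙_{m<2ⁿ} = (w_S(m) + w_{S ∪ {n}}(m))/2`
  (`natWalsh_cutoff`). This replaces the classical separation-of-variables lemma
  (Mauduit–Rivat, Lemme 2) in the dyadic setting.
* Vaughan's three-term identity for `μ` (tree: `Sieve.MoebiusExpSum.moebius_eq_three_terms`,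
  `μ = 2μ_u − μ_u*μ_u*ζ + G_u*(μ − μ_u)`, `G_u = (μ − μ_u)*ζ`, `|G_u| ≤ τ`) summed against a
  finitely supported test function (`sum_moebius_mul_eq_vaughan`).
* The type-II coefficient `G_u` is only divisor-bounded; Bourgain's §2 needs coefficients bounded
  by `1` POINTWISE (they are dropped after van der Corput differencing, (2.2)). We truncate:
  `G_u = G_u 𝟙_{τ ≤ B} + G_u 𝟙_{τ > B}`; the second piece costs, for `|g| ≤ 1` supported on `[1, X]`,
  at most `∑_{k ≤ X} 𝟙_{τ(k) > B} τ(k) · #{ℓ : kℓ ≤ X} ≤ B⁻¹ X ∑_{k ≤ X} τ(k)²/k ≤ B⁻¹ X (1 + log X)⁴`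
  (`truncation_error_le`, with the tree's `sum_sq_card_divisors_div_le`).
* Dyadic boxes `dyBlock i = [2^i, 2^{i+1})`: only boxes with `i + j ≤ n − 1` meet the support, and on
  them every product is `< 2^{n+1}`, so the cutoff identity applies (`box_eq_zero_of_le`,
  `box_cutoff`).

Main statement (`abs_walshSum_moebius_le_boxes`): for all `n`, `u`, `B ≥ 1`, `A ⊆ Fin n`, with
`S = A.map val`, `D_i = [2^i, 2^{i+1})`,

  `|walshSum μ A| ≤ 2u + ½ ∑_{T ∈ {S, S ∪ {n}}} ∑_{i+j<n} ( |∑_{a∈D_i} ∑_{b∈D_j} c(a) w_T(ab)|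
      + B |∑_{a∈D_i} ∑_{b∈D_j} α(a) β(b) w_T(ab)| ) + 2ⁿ(n+1)⁴/B`

where `c = μ_u*μ_u` (`|c| ≤ τ`, `c = 0` beyond `u²`: TYPE I, smooth variable `b`),
`α = G_u𝟙_{τ≤B}/B`, `β = μ − μ_u` (`|α|, |β| ≤ 1`, both vanishing on `[1, u]`: TYPE II).
The analytic estimates of these box sums (Bourgain §2 for type II, §3 for type I) and B. Green's
small-weight bound are NOT in this file.

## References

* J. Bourgain, J. Anal. Math. 119 (2013) 147–163, §3 (first paragraph), (2.1).
  [Bourgain2013MoebiusWalsh]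
* C. Mauduit, J. Rivat, Ann. of Math. 171 (2010) 1591–1646, §4 Lemme 1 (Vaughan's method, for `Λ`).
* H. Iwaniec, E. Kowalski, *Analytic Number Theory*, Prop. 13.4–13.5 (Vaughan's identity for `μ`).
-/

noncomputable section

open Finset Real ArithmeticFunction
open scoped ArithmeticFunction.Moebius ArithmeticFunction.zeta ArithmeticFunction.sigma

namespace Literature.NumberTheory.LFunctions.MoebiusWalshVaughan

open Literature.NumberTheory.Sieve (moebiusTrunc)
open Literature.NumberTheory.Sieve.Vaughan (gU arith_sub_apply gU_eq_zero_of_le abs_gU_le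
  sum_sq_card_divisors_le sum_card_divisors_le sum_card_divisors_div_le card_divisors_mul_le
  card_divisors_eq_sum_antidiagonal sum_Ioc_sum_divisorsAntidiagonal_eq
  sum_Ioc_sum_Ioc_div_eq_sum_sum_ite)
open Literature.NumberTheory.Sieve.MoebiusExpSum (moebius_eq_three_terms moebius_sub_trunc_apply
  abs_moebius_sub_trunc_le abs_trunc_mul_trunc_le trunc_mul_trunc_eq_zero_of_lt
  sum_sq_card_divisors_div_le)
open Literature.Probability.RandomGraphs.LowDegree (walsh sgn)

/-! ### Walsh characters on `ℕ` -/

/-- The Walsh character with digit set `T ⊆ ℕ`, read on natural numbers: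
`w_T(m) = ∏_{j ∈ T} (−1)^{bit_j(m)}` (Bourgain 2013, (0.1), extended periodically). [folklore] -/
def natWalsh (T : Finset ℕ) (m : ℕ) : ℝ := ∏ j ∈ T, (if m.testBit j then (-1 : ℝ) else 1)

/-- `w_∅ = 1`. [folklore] -/
theorem natWalsh_empty (m : ℕ) : natWalsh ∅ m = 1 := by simp [natWalsh]

/-- `|w_T(m)| = 1`. [folklore] -/
theorem abs_natWalsh (T : Finset ℕ) (m : ℕ) : |natWalsh T m| = 1 := by
  unfold natWalsh
  rw [Finset.abs_prod]
  refine Finset.prod_eq_one fun j _ => ?_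
  split_ifs <;> simp

/-- `|w_T(m)| ≤ 1`. [folklore] -/
theorem abs_natWalsh_le (T : Finset ℕ) (m : ℕ) : |natWalsh T m| ≤ 1 := (abs_natWalsh T m).le

/-- `w_{T ∪ {j}}(m) = (−1)^{bit_j(m)} w_T(m)` for `j ∉ T`. [folklore] -/
theorem natWalsh_insert {T : Finset ℕ} {j : ℕ} (hj : j ∉ T) (m : ℕ) :
    natWalsh (insert j T) m = (if m.testBit j then (-1 : ℝ) else 1) * natWalsh T m := by
  unfold natWalsh
  rw [Finset.prod_insert hj]

/-- The `LFunctions` Walsh sum as a sum over `1 ≤ m < 2ⁿ` of `g(m) w_{A}(m)` (the term `m = 0` is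
dropped when `g 0 = 0`, as for `μ` and `λ`). [folklore] -/
theorem walshSum_eq_sum_Ico_natWalsh {n : ℕ} (g : ℕ → ℤ) (hg : g 0 = 0) (A : Finset (Fin n)) :
    walshSum g A = ∑ m ∈ Ico 1 (2 ^ n), (g m : ℝ) * natWalsh (A.map Fin.valEmbedding) m := by
  rw [Literature.NumberTheory.Sieve.MoebiusWalsh.walshSum_eq_sum_range]
  have h0 : range (2 ^ n) = insert 0 (Ico 1 (2 ^ n)) := by
    have h2 := Nat.two_pow_pos n
    ext m; simp only [mem_range, mem_insert, mem_Ico]; omega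
  rw [h0, Finset.sum_insert (by simp), hg]
  simp only [Int.cast_zero, zero_mul, zero_add]
  refine Finset.sum_congr rfl fun m _ => ?_
  congr 1
  unfold natWalsh walsh sgn
  rw [Finset.prod_map]
  rfl

/-- **The cutoff is a Walsh character one digit up**: for `m < 2^{n+1}` and `n ∉ T`,
`w_T(m) 𝟙_{m < 2ⁿ} = (w_T(m) + w_{T ∪ {n}}(m))/2`. [folklore] -/
theorem natWalsh_cutoff {T : Finset ℕ} {n m : ℕ} (hn : n ∉ T) (hm : m < 2 ^ (n + 1)) :
    (if m < 2 ^ n then natWalsh T m else 0) =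
      (natWalsh T m + natWalsh (insert n T) m) / 2 := by
  rw [natWalsh_insert hn, Nat.testBit_eq_decide_div_mod_eq]
  by_cases h : m < 2 ^ n
  · rw [if_pos h, Nat.div_eq_of_lt h]
    simp
  · rw [if_neg h]
    have h1 : m / 2 ^ n = 1 := by
      refine Nat.div_eq_of_lt_le ?_ ?_
      · rw [one_mul]; exact Nat.not_lt.mp h
      · rw [pow_succ] at hm; linarith
    rw [h1]
    simp

/-! ### Dyadic blocks -/

/-- The dyadic block `D_i = [2^i, 2^{i+1})`. [folklore] -/
def dyBlock (i : ℕ) : Finset ℕ := Ico (2 ^ i) (2 ^ (i + 1))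

/-- Membership in the dyadic block `D_i`. [folklore] -/
theorem mem_dyBlock {i a : ℕ} : a ∈ dyBlock i ↔ 2 ^ i ≤ a ∧ a < 2 ^ (i + 1) := by
  rw [dyBlock, mem_Ico]

/-- `∑_{1 ≤ a < 2ⁿ} F(a) = ∑_{i < n} ∑_{a ∈ D_i} F(a)`. [folklore] -/
theorem sum_Ico_one_eq_sum_dyBlock {M : Type*} [AddCommMonoid M] (F : ℕ → M) (n : ℕ) :
    ∑ a ∈ Ico 1 (2 ^ n), F a = ∑ i ∈ range n, ∑ a ∈ dyBlock i, F a := by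
  induction n with
  | zero => simp
  | succ n ih =>
    rw [Finset.sum_range_succ, ← ih, dyBlock, Finset.sum_Ico_consecutive _ Nat.one_le_two_pow
      (Nat.pow_le_pow_right Nat.two_pos (Nat.le_succ n))]

/-- Products from the box `D_i × D_j` lie in `[2^{i+j}, 2^{i+j+2})`. [folklore] -/
theorem mul_mem_of_mem_dyBlock {i j a b : ℕ} (ha : a ∈ dyBlock i) (hb : b ∈ dyBlock j) :
    2 ^ (i + j) ≤ a * b ∧ a * b < 2 ^ (i + j + 2) := by
  rw [mem_dyBlock] at ha hb
  constructor
  · rw [pow_add]; exact Nat.mul_le_mul ha.1 hb.1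
  · calc a * b < 2 ^ (i + 1) * 2 ^ (j + 1) :=
          Nat.mul_lt_mul_of_lt_of_le ha.2 hb.2.le (Nat.two_pow_pos _)
      _ = 2 ^ (i + j + 2) := by rw [← pow_add]; ring_nf

/-- `∑_{1 ≤ a ≤ N} G(a) = ∑_{1 ≤ a < N} G(a)` when `G(N) = 0`. [folklore] -/
theorem sum_Ioc_zero_eq_sum_Ico_one {M : Type*} [AddCommMonoid M] {G : ℕ → M} {N : ℕ} (hN : 0 < N)
    (hG : G N = 0) : ∑ a ∈ Ioc 0 N, G a = ∑ a ∈ Ico 1 N, G a := by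
  have h : Ioc 0 N = insert N (Ico 1 N) := by
    ext a; simp only [mem_Ioc, mem_insert, mem_Ico]; omega
  rw [h, Finset.sum_insert (by simp), hG, zero_add]

/-- The box sum over `D_i × D_j` of `α(a) β(b) w_T(ab)` (Bourgain 2013, (2.1), with `m ∼ 2^i`,
`n ∼ 2^j`). [cite: Bourgain2013MoebiusWalsh, (2.1)] -/
def boxSum (T : Finset ℕ) (i j : ℕ) (α β : ℕ → ℝ) : ℝ :=
  ∑ a ∈ dyBlock i, ∑ b ∈ dyBlock j, α a * β b * natWalsh T (a * b)

/-- Trivial bound: `|boxSum| ≤ (∑_{a ∈ D_i} |α a|) · 2^j` for `|β| ≤ 1`. [folklore] -/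
theorem abs_boxSum_le (T : Finset ℕ) (i j : ℕ) (α β : ℕ → ℝ) (hβ : ∀ b, |β b| ≤ 1) :
    |boxSum T i j α β| ≤ (∑ a ∈ dyBlock i, |α a|) * 2 ^ j := by
  unfold boxSum
  refine (Finset.abs_sum_le_sum_abs _ _).trans ?_
  rw [Finset.sum_mul]
  refine Finset.sum_le_sum fun a _ => (Finset.abs_sum_le_sum_abs _ _).trans ?_
  have hcard : ((dyBlock j).card : ℝ) = 2 ^ j := by
    have h : 2 ^ (j + 1) - 2 ^ j = 2 ^ j := by rw [pow_succ]; omega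
    rw [dyBlock, Nat.card_Ico, h]; push_cast; ring
  calc ∑ b ∈ dyBlock j, |α a * β b * natWalsh T (a * b)| ≤ ∑ _b ∈ dyBlock j, |α a| := by
        refine Finset.sum_le_sum fun b _ => ?_
        rw [abs_mul, abs_mul, abs_natWalsh, mul_one]
        calc |α a| * |β b| ≤ |α a| * 1 := mul_le_mul_of_nonneg_left (hβ b) (abs_nonneg _)
          _ = |α a| := mul_one _
    _ = |α a| * 2 ^ j := by rw [Finset.sum_const, nsmul_eq_mul, hcard, mul_comm]

/-! ### Dirichlet convolutions summed against a finitely supported test function -/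

/-- `∑_{m ≤ X} (f * h)(m) g(m) = ∑_{a ≤ X} ∑_{b ≤ X} f(a) h(b) g(ab)` when `g` vanishes beyond `X`.
[folklore] -/
theorem sum_mul_conv_eq (f h : ArithmeticFunction ℝ) {g : ℕ → ℝ} {X : ℕ}
    (hg : ∀ m, X < m → g m = 0) :
    ∑ m ∈ Ioc 0 X, (f * h) m * g m = ∑ a ∈ Ioc 0 X, ∑ b ∈ Ioc 0 X, f a * h b * g (a * b) := by
  have h1 : ∀ m ∈ Ioc 0 X, (f * h) m * g m =
      ∑ x ∈ m.divisorsAntidiagonal, f x.1 * h x.2 * g (x.1 * x.2) := by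
    intro m _
    rw [ArithmeticFunction.mul_apply, Finset.sum_mul]
    refine Finset.sum_congr rfl fun x hx => ?_
    rw [(Nat.mem_divisorsAntidiagonal.mp hx).1]
  rw [Finset.sum_congr rfl h1,
    sum_Ioc_sum_divisorsAntidiagonal_eq (fun a b => f a * h b * g (a * b)) X,
    sum_Ioc_sum_Ioc_div_eq_sum_sum_ite (fun a b => f a * h b * g (a * b)) le_rfl le_rfl]
  refine Finset.sum_congr rfl fun a _ => Finset.sum_congr rfl fun b _ => ?_
  split_ifs with hab
  · rfl
  · rw [hg _ (Nat.not_le.mp hab), mul_zero]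

/-- A box sum over `[1, 2ⁿ]²` whose summand vanishes when a coordinate equals `2ⁿ` (and the other
is positive), as a double dyadic sum `∑_{i<n} ∑_{j<n} ∑_{a ∈ D_i} ∑_{b ∈ D_j}`. [folklore] -/
theorem sum_Ioc_sum_Ioc_eq_sum_dyBlock (F : ℕ → ℕ → ℝ) (n : ℕ)
    (hF1 : ∀ b, 0 < b → F (2 ^ n) b = 0) (hF2 : ∀ a, 0 < a → F a (2 ^ n) = 0) :
    ∑ a ∈ Ioc 0 (2 ^ n), ∑ b ∈ Ioc 0 (2 ^ n), F a b =
      ∑ i ∈ range n, ∑ j ∈ range n, ∑ a ∈ dyBlock i, ∑ b ∈ dyBlock j, F a b := by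
  have hN : 0 < 2 ^ n := Nat.two_pow_pos n
  have hin : ∀ a ∈ Ioc 0 (2 ^ n), ∑ b ∈ Ioc 0 (2 ^ n), F a b = ∑ b ∈ Ico 1 (2 ^ n), F a b :=
    fun a ha => sum_Ioc_zero_eq_sum_Ico_one hN (hF2 a (mem_Ioc.mp ha).1)
  rw [Finset.sum_congr rfl hin]
  rw [sum_Ioc_zero_eq_sum_Ico_one hN
    (Finset.sum_eq_zero fun b hb => hF1 b (by have := (mem_Ico.mp hb).1; omega))]
  rw [sum_Ico_one_eq_sum_dyBlock]
  refine Finset.sum_congr rfl fun i _ => ?_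
  rw [Finset.sum_congr rfl fun a _ => sum_Ico_one_eq_sum_dyBlock (F a) n, Finset.sum_comm]

/-- Only boxes with `i + j < n` meet the support of a function vanishing on `[2ⁿ, ∞)`. [folklore] -/
theorem box_eq_zero_of_le {g : ℕ → ℝ} {n : ℕ} (hg : ∀ m, 2 ^ n ≤ m → g m = 0) {i j : ℕ}
    (hij : n ≤ i + j) (φ : ℕ → ℕ → ℝ) :
    ∑ a ∈ dyBlock i, ∑ b ∈ dyBlock j, φ a b * g (a * b) = 0 := by
  refine Finset.sum_eq_zero fun a ha => Finset.sum_eq_zero fun b hb => ?_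
  rw [hg _ (((Nat.pow_le_pow_right Nat.two_pos hij).trans (mul_mem_of_mem_dyBlock ha hb).1)),
    mul_zero]

/-- Restricting the double dyadic sum to the boxes `i + j < n`. [folklore] -/
theorem sum_range_sum_range_eq_of_vanish (G : ℕ → ℕ → ℝ) (n : ℕ)
    (hG : ∀ i j, n ≤ i + j → G i j = 0) :
    ∑ i ∈ range n, ∑ j ∈ range n, G i j = ∑ i ∈ range n, ∑ j ∈ range (n - i), G i j := by
  refine Finset.sum_congr rfl fun i hi => ?_
  have hi' := mem_range.mp hi
  symm
  refine Finset.sum_subset (range_subset_range.mpr (Nat.sub_le n i)) fun j hj hj' => ?_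
  rw [mem_range] at hj hj'
  exact hG i j (by omega)

/-- On a box `D_i × D_j` with `i + j < n` every product is `< 2^{n+1}`, so the cutoff identity
`natWalsh_cutoff` applies termwise:
`∑∑ φ(a,b) w_S(ab)𝟙_{ab<2ⁿ} = ½ (∑∑ φ(a,b) w_S(ab) + ∑∑ φ(a,b) w_{S∪{n}}(ab))`. [folklore] -/
theorem box_cutoff {S : Finset ℕ} {n : ℕ} (hn : n ∉ S) {i j : ℕ} (hij : i + j < n)
    (φ : ℕ → ℕ → ℝ) :
    ∑ a ∈ dyBlock i, ∑ b ∈ dyBlock j, φ a b * (if a * b < 2 ^ n then natWalsh S (a * b) else 0) =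
      (∑ a ∈ dyBlock i, ∑ b ∈ dyBlock j, φ a b * natWalsh S (a * b) +
        ∑ a ∈ dyBlock i, ∑ b ∈ dyBlock j, φ a b * natWalsh (insert n S) (a * b)) / 2 := by
  rw [← Finset.sum_add_distrib, Finset.sum_div]
  refine Finset.sum_congr rfl fun a ha => ?_
  rw [← Finset.sum_add_distrib, Finset.sum_div]
  refine Finset.sum_congr rfl fun b hb => ?_
  have hlt : a * b < 2 ^ (n + 1) :=
    (mul_mem_of_mem_dyBlock ha hb).2.trans_le (Nat.pow_le_pow_right Nat.two_pos (by omega))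
  rw [natWalsh_cutoff hn hlt]
  ring

/-! ### The truncation of the divisor-bounded coefficient -/

/-- **Cost of truncating a divisor-bounded coefficient at height `B`**: for `|g| ≤ 1` vanishing
beyond `X` and `B ≥ 1`,
`∑_{k ≤ X} ∑_{ℓ ≤ X} 𝟙_{τ(k) > B} τ(k) |g(kℓ)| ≤ X (1 + log X)⁴ / B`
(at most `X/k` values of `ℓ` contribute, `𝟙_{τ > B} τ ≤ τ²/B`, and `∑_{k ≤ X} τ(k)²/k ≤ (1+log X)⁴`).
[folklore] -/
theorem truncation_error_le {g : ℕ → ℝ} {X B : ℕ} (hB : 1 ≤ B) (hg1 : ∀ m, |g m| ≤ 1)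
    (hg0 : ∀ m, X < m → g m = 0) :
    ∑ k ∈ Ioc 0 X, ∑ ℓ ∈ Ioc 0 X,
        (if (B : ℝ) < (σ 0 k : ℝ) then (σ 0 k : ℝ) else 0) * |g (k * ℓ)| ≤
      X * (1 + Real.log X) ^ 4 / B := by
  have hB0 : (0 : ℝ) < B := by exact_mod_cast hB
  -- inner sum: at most `X / k` nonzero terms, each `≤ 1`
  have hinner : ∀ k ∈ Ioc 0 X, ∑ ℓ ∈ Ioc 0 X, |g (k * ℓ)| ≤ (X : ℝ) / k := by
    intro k hk
    have hk0 : 0 < k := (mem_Ioc.mp hk).1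
    have hvan : ∀ ℓ, X / k < ℓ → ℓ ≤ X → |g (k * ℓ)| = 0 := by
      intro ℓ hℓ _
      rw [hg0 _ ?_, abs_zero]
      rw [Nat.div_lt_iff_lt_mul hk0] at hℓ
      rwa [mul_comm] at hℓ
    rw [Literature.NumberTheory.Sieve.Vaughan.sum_Ioc_eq_sum_Ioc_of_eq_zero (Nat.div_le_self X k) hvan]
    calc ∑ ℓ ∈ Ioc 0 (X / k), |g (k * ℓ)| ≤ ∑ _ℓ ∈ Ioc 0 (X / k), (1 : ℝ) :=
          Finset.sum_le_sum fun ℓ _ => hg1 _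
      _ = ((X / k : ℕ) : ℝ) := by simp
      _ ≤ (X : ℝ) / k := Nat.cast_div_le
  calc ∑ k ∈ Ioc 0 X, ∑ ℓ ∈ Ioc 0 X, (if (B : ℝ) < (σ 0 k : ℝ) then (σ 0 k : ℝ) else 0) * |g (k * ℓ)|
      = ∑ k ∈ Ioc 0 X, (if (B : ℝ) < (σ 0 k : ℝ) then (σ 0 k : ℝ) else 0) *
          ∑ ℓ ∈ Ioc 0 X, |g (k * ℓ)| := by
        refine Finset.sum_congr rfl fun k _ => by rw [Finset.mul_sum]
    _ ≤ ∑ k ∈ Ioc 0 X, ((σ 0 k : ℝ) ^ 2 / B) * ((X : ℝ) / k) := by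
        refine Finset.sum_le_sum fun k hk => ?_
        refine mul_le_mul ?_ (hinner k hk) (Finset.sum_nonneg fun _ _ => abs_nonneg _)
          (by positivity)
        split_ifs with h
        · rw [le_div_iff₀ hB0, sq]
          exact mul_le_mul_of_nonneg_left h.le (Nat.cast_nonneg _)
        · positivity
    _ = (X : ℝ) / B * ∑ k ∈ Ioc 0 X, ((#k.divisors : ℕ) : ℝ) ^ 2 / k := by
        rw [Finset.mul_sum]
        refine Finset.sum_congr rfl fun k _ => ?_
        rw [ArithmeticFunction.sigma_zero_apply]
        ring
    _ ≤ (X : ℝ) / B * (1 + Real.log X) ^ 4 :=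
        mul_le_mul_of_nonneg_left (sum_sq_card_divisors_div_le X) (by positivity)
    _ = X * (1 + Real.log X) ^ 4 / B := by ring

/-! ### The coefficient sequences of the reduction -/

/-- The TYPE-I coefficient `c = μ_u * μ_u` (`c(a) = ∑_{a₁a₂ = a, a₁, a₂ ≤ u} μ(a₁)μ(a₂)`), supported
on `a ≤ u²`, `|c| ≤ τ`. [cite: Bourgain2013MoebiusWalsh, §3 (via [M-R] Lemme 1, sum `S₂`)] -/
def typeICoeff (u : ℕ) : ℕ → ℝ := fun a =>
  ((moebiusTrunc u : ArithmeticFunction ℝ) * (moebiusTrunc u : ArithmeticFunction ℝ)) a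

/-- `|c(a)| ≤ τ(a)`. [folklore] -/
theorem abs_typeICoeff_le (u a : ℕ) : |typeICoeff u a| ≤ (σ 0 a : ℝ) := by
  rw [ArithmeticFunction.sigma_zero_apply]
  exact abs_trunc_mul_trunc_le u a

/-- `c(a) = 0` for `a > u²`. [folklore] -/
theorem typeICoeff_eq_zero {u a : ℕ} (h : u * u < a) : typeICoeff u a = 0 :=
  trunc_mul_trunc_eq_zero_of_lt h

/-- The first TYPE-II coefficient `α = G_u 𝟙_{τ ≤ B} / B`, `G_u = (μ − μ_u) * ζ`
(`G_u(k) = ∑_{d ∣ k, d > u} μ(d)`): `|α| ≤ 1`, `α = 0` on `[1, u]`.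
[cite: Bourgain2013MoebiusWalsh, §2 (coefficients `α_m`)] -/
def typeIICoeffA (u B : ℕ) : ℕ → ℝ := fun k =>
  if (σ 0 k : ℝ) ≤ B then gU u k / B else 0

/-- `|α(k)| ≤ 1` (for `B ≥ 1`). [folklore] -/
theorem abs_typeIICoeffA_le {B : ℕ} (hB : 1 ≤ B) (u k : ℕ) : |typeIICoeffA u B k| ≤ 1 := by
  unfold typeIICoeffA
  have hB0 : (0 : ℝ) < B := by exact_mod_cast hB
  split_ifs with h
  · rw [abs_div, abs_of_pos hB0, div_le_one hB0]
    exact (abs_gU_le u k).trans h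
  · simp

/-- `α(k) = 0` for `k ≤ u`. [folklore] -/
theorem typeIICoeffA_eq_zero {u k : ℕ} (B : ℕ) (hk : k ≤ u) : typeIICoeffA u B k = 0 := by
  unfold typeIICoeffA
  rw [gU_eq_zero_of_le hk]
  simp

/-- The second TYPE-II coefficient `β = μ − μ_u` (`β(ℓ) = μ(ℓ) 𝟙_{ℓ > u}`): `|β| ≤ 1`, `β = 0` on
`[1, u]`. [cite: Bourgain2013MoebiusWalsh, §2 (coefficients `β_n`)] -/
def typeIICoeffB (u : ℕ) : ℕ → ℝ := fun ℓ =>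
  ((μ : ArithmeticFunction ℝ) - (moebiusTrunc u : ArithmeticFunction ℝ)) ℓ

/-- `β(ℓ) = μ(ℓ) 𝟙_{ℓ > u}`. [folklore] -/
theorem typeIICoeffB_apply (u ℓ : ℕ) : typeIICoeffB u ℓ = if ℓ ≤ u then 0 else (μ ℓ : ℝ) :=
  moebius_sub_trunc_apply u ℓ

/-- `|β(ℓ)| ≤ 1`. [folklore] -/
theorem abs_typeIICoeffB_le (u ℓ : ℕ) : |typeIICoeffB u ℓ| ≤ 1 := abs_moebius_sub_trunc_le u ℓ

/-- `β(ℓ) = 0` for `ℓ ≤ u`. [folklore] -/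
theorem typeIICoeffB_eq_zero {u ℓ : ℕ} (hℓ : ℓ ≤ u) : typeIICoeffB u ℓ = 0 := by
  rw [typeIICoeffB_apply, if_pos hℓ]

/-! ### The reduction -/

/-- `|∑_{m ≤ N} μ_u(m) g(m)| ≤ u` for `|g| ≤ 1`. [folklore] -/
theorem abs_sum_moebiusTrunc_mul_le (u N : ℕ) {g : ℕ → ℝ} (hg1 : ∀ m, |g m| ≤ 1) :
    |∑ m ∈ Ioc 0 N, (moebiusTrunc u : ArithmeticFunction ℝ) m * g m| ≤ u := by
  refine (Finset.abs_sum_le_sum_abs _ _).trans ?_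
  calc ∑ m ∈ Ioc 0 N, |(moebiusTrunc u : ArithmeticFunction ℝ) m * g m|
      ≤ ∑ m ∈ Ioc 0 N, (if m ≤ u then (1 : ℝ) else 0) := by
        refine Finset.sum_le_sum fun m _ => ?_
        rw [abs_mul, ArithmeticFunction.intCoe_apply, Literature.NumberTheory.Sieve.moebiusTrunc_apply]
        split_ifs with h
        · calc |((μ m : ℤ) : ℝ)| * |g m| ≤ 1 * 1 := by
                refine mul_le_mul ?_ (hg1 m) (abs_nonneg _) zero_le_one
                exact_mod_cast abs_moebius_le_one
            _ = 1 := one_mul _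
        · simp
    _ = (((Ioc 0 N).filter (fun m => m ≤ u)).card : ℝ) := by
        rw [Finset.sum_ite, Finset.sum_const_zero, add_zero, Finset.sum_const, nsmul_eq_mul, mul_one]
    _ ≤ ((Ioc 0 u).card : ℝ) := by
        have hsub : (Ioc 0 N).filter (fun m => m ≤ u) ⊆ Ioc 0 u := by
          intro m hm; simp only [mem_filter, mem_Ioc] at hm ⊢; omega
        exact_mod_cast Finset.card_le_card hsub
    _ = u := by simp

/-- **Vaughan's identity for `μ` summed against a test function** supported on `[1, X]`:
`∑_{m≤X} μ(m)g(m) = 2∑ μ_u g − ∑_{a,b ≤ X} c(a) g(ab) + ∑_{k,ℓ ≤ X} G_u(k) β(ℓ) g(kℓ)`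
(`c = μ_u*μ_u`, `β = μ − μ_u`). [cite: Bourgain2013MoebiusWalsh, §3 (via [M-R] Lemme 1)] -/
theorem sum_moebius_mul_eq_vaughan (u X : ℕ) {g : ℕ → ℝ} (hg0 : ∀ m, X < m → g m = 0) :
    ∑ m ∈ Ioc 0 X, (μ m : ℝ) * g m =
      2 * ∑ m ∈ Ioc 0 X, (moebiusTrunc u : ArithmeticFunction ℝ) m * g m -
        ∑ a ∈ Ioc 0 X, ∑ b ∈ Ioc 0 X, typeICoeff u a * 1 * g (a * b) +
        ∑ k ∈ Ioc 0 X, ∑ ℓ ∈ Ioc 0 X, gU u k * typeIICoeffB u ℓ * g (k * ℓ) := by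
  have hV := moebius_eq_three_terms u
  have hpt : ∀ m ∈ Ioc 0 X, (μ m : ℝ) * g m =
      (moebiusTrunc u : ArithmeticFunction ℝ) m * g m +
        (moebiusTrunc u : ArithmeticFunction ℝ) m * g m -
        ((moebiusTrunc u : ArithmeticFunction ℝ) * (moebiusTrunc u : ArithmeticFunction ℝ) *
          (ζ : ArithmeticFunction ℝ)) m * g m +
        (gU u * ((μ : ArithmeticFunction ℝ) - (moebiusTrunc u : ArithmeticFunction ℝ))) m * g m := by
    intro m _
    have h := congrArg (fun F : ArithmeticFunction ℝ => F m) hV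
    simp only [ArithmeticFunction.add_apply, arith_sub_apply] at h
    rw [ArithmeticFunction.intCoe_apply (f := ArithmeticFunction.moebius)] at h
    rw [h]
    ring
  rw [Finset.sum_congr rfl hpt, Finset.sum_add_distrib, Finset.sum_sub_distrib,
    Finset.sum_add_distrib, ← two_mul]
  -- the type I term
  have hI : ∑ m ∈ Ioc 0 X, ((moebiusTrunc u : ArithmeticFunction ℝ) *
      (moebiusTrunc u : ArithmeticFunction ℝ) * (ζ : ArithmeticFunction ℝ)) m * g m =
      ∑ a ∈ Ioc 0 X, ∑ b ∈ Ioc 0 X, typeICoeff u a * 1 * g (a * b) := by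
    rw [sum_mul_conv_eq _ _ hg0]
    refine Finset.sum_congr rfl fun a _ => Finset.sum_congr rfl fun b hb => ?_
    have hb1 : b ≠ 0 := by have := (mem_Ioc.mp hb).1; omega
    rw [ArithmeticFunction.natCoe_apply, ArithmeticFunction.zeta_apply_ne hb1]
    simp [typeICoeff]
  -- the type II term
  have hII : ∑ m ∈ Ioc 0 X, (gU u * ((μ : ArithmeticFunction ℝ) -
      (moebiusTrunc u : ArithmeticFunction ℝ))) m * g m =
      ∑ k ∈ Ioc 0 X, ∑ ℓ ∈ Ioc 0 X, gU u k * typeIICoeffB u ℓ * g (k * ℓ) := by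
    rw [sum_mul_conv_eq _ _ hg0]
    rfl
  rw [hI, hII]

/-- `(1 + log 2ⁿ)⁴ ≤ (n + 1)⁴`. [folklore] -/
theorem one_add_log_two_pow_le (n : ℕ) : (1 + Real.log ((2 : ℝ) ^ n)) ^ 4 ≤ ((n : ℝ) + 1) ^ 4 := by
  have h2 : Real.log 2 ≤ 1 := by have := Real.log_two_lt_d9; linarith
  have hlog : Real.log ((2 : ℝ) ^ n) ≤ n := by
    rw [Real.log_pow]
    calc (n : ℝ) * Real.log 2 ≤ n * 1 := mul_le_mul_of_nonneg_left h2 (Nat.cast_nonneg n)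
      _ = n := mul_one _
  have h0 : 0 ≤ 1 + Real.log ((2 : ℝ) ^ n) := by
    have : 0 ≤ Real.log ((2 : ℝ) ^ n) := Real.log_nonneg (one_le_pow₀ (by norm_num))
    linarith
  exact pow_le_pow_left₀ h0 (by linarith) 4

/-- **The Vaughan reduction of the Möbius–Walsh sum to dyadic box sums** (Bourgain 2013, §3 with
[M-R] Lemme 1, made explicit for `μ`; cutoff removed by `natWalsh_cutoff`, type-II coefficient
truncated at divisor height `B`): for all `n, u` and `B ≥ 1`, with `S = A.map val`,
`|walshSum μ A| ≤ 2u + ½ ∑_{i<n} ∑_{j<n-i} (|box_I(S)| + |box_I(S ∪ {n})|)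
  + (B/2) ∑_{i<n} ∑_{j<n-i} (|box_II(S)| + |box_II(S ∪ {n})|) + 2ⁿ (n+1)⁴ / B`,
where `box_I(T) = boxSum T i j (typeICoeff u) 1` and
`box_II(T) = boxSum T i j (typeIICoeffA u B) (typeIICoeffB u)`.
[cite: Bourgain2013MoebiusWalsh, §3 (reduction to (2.1), (3.1))] -/
theorem abs_walshSum_moebius_le_boxes (n u B : ℕ) (hB : 1 ≤ B) (A : Finset (Fin n)) :
    |walshSum (fun m => (μ m : ℤ)) A| ≤
      2 * u +
      (1 / 2) * ∑ i ∈ range n, ∑ j ∈ range (n - i),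
        (|boxSum (A.map Fin.valEmbedding) i j (typeICoeff u) (fun _ => 1)| +
          |boxSum (insert n (A.map Fin.valEmbedding)) i j (typeICoeff u) (fun _ => 1)|) +
      (B / 2) * ∑ i ∈ range n, ∑ j ∈ range (n - i),
        (|boxSum (A.map Fin.valEmbedding) i j (typeIICoeffA u B) (typeIICoeffB u)| +
          |boxSum (insert n (A.map Fin.valEmbedding)) i j (typeIICoeffA u B) (typeIICoeffB u)|) +
      2 ^ n * ((n : ℝ) + 1) ^ 4 / B := by
  set S : Finset ℕ := A.map Fin.valEmbedding with hS
  set N : ℕ := 2 ^ n with hNdef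
  have hN : 0 < N := Nat.two_pow_pos n
  have hB0 : (0 : ℝ) < B := by exact_mod_cast hB
  have hnS : n ∉ S := by
    rw [hS, Finset.mem_map]
    rintro ⟨j, -, hj⟩
    have h1 : (j : ℕ) = n := hj
    have h2 := j.isLt
    omega
  set g : ℕ → ℝ := fun m => if m < N then natWalsh S m else 0 with hgdef
  have hg1 : ∀ m, |g m| ≤ 1 := by
    intro m; simp only [hgdef]; split_ifs
    · exact abs_natWalsh_le S m
    · simp
  have hgN : ∀ m, N ≤ m → g m = 0 := fun m hm => by
    simp only [hgdef]; rw [if_neg (Nat.not_lt.mpr hm)]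
  have hg0 : ∀ m, N < m → g m = 0 := fun m hm => hgN m hm.le
  -- Step 1: the Walsh sum as `∑_{m ≤ N} μ(m) g(m)`
  have h1 : walshSum (fun m => (μ m : ℤ)) A = ∑ m ∈ Ioc 0 N, (μ m : ℝ) * g m := by
    rw [walshSum_eq_sum_Ico_natWalsh _ (by simp) A,
      sum_Ioc_zero_eq_sum_Ico_one hN (by rw [hgN N le_rfl, mul_zero])]
    refine Finset.sum_congr rfl fun m hm => ?_
    simp only [hgdef]
    rw [if_pos (mem_Ico.mp hm).2]
  -- Step 2: Vaughan
  rw [h1, sum_moebius_mul_eq_vaughan u N hg0]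
  -- Step 3: boxes for the type I term
  have hboxI : ∑ a ∈ Ioc 0 N, ∑ b ∈ Ioc 0 N, typeICoeff u a * 1 * g (a * b) =
      ∑ i ∈ range n, ∑ j ∈ range (n - i),
        (boxSum S i j (typeICoeff u) (fun _ => 1) +
          boxSum (insert n S) i j (typeICoeff u) (fun _ => 1)) / 2 := by
    rw [sum_Ioc_sum_Ioc_eq_sum_dyBlock (fun a b => typeICoeff u a * 1 * g (a * b)) n
      (fun b hb => by rw [hgN _ (Nat.le_mul_of_pos_right _ hb), mul_zero])
      (fun a ha => by rw [hgN _ (Nat.le_mul_of_pos_left _ ha), mul_zero])]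
    rw [sum_range_sum_range_eq_of_vanish _ n
      (fun i j hij => box_eq_zero_of_le hgN hij (fun a _ => typeICoeff u a * 1))]
    refine Finset.sum_congr rfl fun i hi => Finset.sum_congr rfl fun j hj => ?_
    have hij : i + j < n := by
      have := mem_range.mp hi; have := mem_range.mp hj; omega
    unfold boxSum
    exact box_cutoff hnS hij (fun a _ => typeICoeff u a * 1)
  -- Step 4: split the type II coefficient and box the bounded part
  have hsplit : ∀ k, gU u k = B * typeIICoeffA u B k +
      (if (σ 0 k : ℝ) ≤ B then 0 else gU u k) := by
    intro k
    unfold typeIICoeffA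
    split_ifs with h
    · rw [mul_div_cancel₀ _ hB0.ne', add_zero]
    · ring
  have hII : ∑ k ∈ Ioc 0 N, ∑ ℓ ∈ Ioc 0 N, gU u k * typeIICoeffB u ℓ * g (k * ℓ) =
      B * ∑ k ∈ Ioc 0 N, ∑ ℓ ∈ Ioc 0 N, typeIICoeffA u B k * typeIICoeffB u ℓ * g (k * ℓ) +
        ∑ k ∈ Ioc 0 N, ∑ ℓ ∈ Ioc 0 N,
          (if (σ 0 k : ℝ) ≤ B then 0 else gU u k) * typeIICoeffB u ℓ * g (k * ℓ) := by
    rw [Finset.mul_sum, ← Finset.sum_add_distrib]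
    refine Finset.sum_congr rfl fun k _ => ?_
    rw [Finset.mul_sum, ← Finset.sum_add_distrib]
    refine Finset.sum_congr rfl fun ℓ _ => ?_
    conv_lhs => rw [hsplit k]
    ring
  have hboxII : ∑ k ∈ Ioc 0 N, ∑ ℓ ∈ Ioc 0 N, typeIICoeffA u B k * typeIICoeffB u ℓ * g (k * ℓ) =
      ∑ i ∈ range n, ∑ j ∈ range (n - i),
        (boxSum S i j (typeIICoeffA u B) (typeIICoeffB u) +
          boxSum (insert n S) i j (typeIICoeffA u B) (typeIICoeffB u)) / 2 := by
    rw [sum_Ioc_sum_Ioc_eq_sum_dyBlock (fun k ℓ => typeIICoeffA u B k * typeIICoeffB u ℓ * g (k * ℓ)) n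
      (fun b hb => by rw [hgN _ (Nat.le_mul_of_pos_right _ hb), mul_zero])
      (fun a ha => by rw [hgN _ (Nat.le_mul_of_pos_left _ ha), mul_zero])]
    rw [sum_range_sum_range_eq_of_vanish _ n
      (fun i j hij => box_eq_zero_of_le hgN hij (fun k ℓ => typeIICoeffA u B k * typeIICoeffB u ℓ))]
    refine Finset.sum_congr rfl fun i hi => Finset.sum_congr rfl fun j hj => ?_
    have hij : i + j < n := by
      have := mem_range.mp hi; have := mem_range.mp hj; omega
    unfold boxSum
    exact box_cutoff hnS hij (fun k ℓ => typeIICoeffA u B k * typeIICoeffB u ℓ)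
  -- Step 5: the truncation error
  have herr : |∑ k ∈ Ioc 0 N, ∑ ℓ ∈ Ioc 0 N,
      (if (σ 0 k : ℝ) ≤ B then 0 else gU u k) * typeIICoeffB u ℓ * g (k * ℓ)| ≤
      2 ^ n * ((n : ℝ) + 1) ^ 4 / B := by
    refine (Finset.abs_sum_le_sum_abs _ _).trans ?_
    refine (Finset.sum_le_sum fun k _ => Finset.abs_sum_le_sum_abs _ _).trans ?_
    have hterm : ∀ k ℓ, |(if (σ 0 k : ℝ) ≤ B then 0 else gU u k) * typeIICoeffB u ℓ * g (k * ℓ)| ≤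
        (if (B : ℝ) < (σ 0 k : ℝ) then (σ 0 k : ℝ) else 0) * |g (k * ℓ)| := by
      intro k ℓ
      rw [abs_mul, abs_mul]
      refine mul_le_mul ?_ le_rfl (abs_nonneg _) ?_
      · split_ifs with h1 h2 h2
        · simp
        · simp
        · calc |gU u k| * |typeIICoeffB u ℓ| ≤ (σ 0 k : ℝ) * 1 :=
              mul_le_mul (abs_gU_le u k) (abs_typeIICoeffB_le u ℓ) (abs_nonneg _)
                (Nat.cast_nonneg _)
            _ = (σ 0 k : ℝ) := mul_one _
        · exact absurd (le_of_not_gt h2) h1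
      · split_ifs <;> positivity
    refine (Finset.sum_le_sum fun k _ => Finset.sum_le_sum fun ℓ _ => hterm k ℓ).trans ?_
    refine (truncation_error_le hB hg1 hg0).trans ?_
    rw [hNdef]
    push_cast
    exact div_le_div_of_nonneg_right (mul_le_mul_of_nonneg_left (one_add_log_two_pow_le n)
      (by positivity)) hB0.le
  -- Step 6: assemble
  have hT1 := abs_sum_moebiusTrunc_mul_le u N hg1
  rw [hboxI, hII, hboxII]
  set BI := ∑ i ∈ range n, ∑ j ∈ range (n - i),
    (|boxSum S i j (typeICoeff u) (fun _ => 1)| +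
      |boxSum (insert n S) i j (typeICoeff u) (fun _ => 1)|) with hBI
  set BII := ∑ i ∈ range n, ∑ j ∈ range (n - i),
    (|boxSum S i j (typeIICoeffA u B) (typeIICoeffB u)| +
      |boxSum (insert n S) i j (typeIICoeffA u B) (typeIICoeffB u)|) with hBII
  have hI' : |∑ i ∈ range n, ∑ j ∈ range (n - i),
      (boxSum S i j (typeICoeff u) (fun _ => 1) +
        boxSum (insert n S) i j (typeICoeff u) (fun _ => 1)) / 2| ≤ (1 / 2) * BI := by
    rw [hBI, Finset.mul_sum]
    refine (Finset.abs_sum_le_sum_abs _ _).trans (Finset.sum_le_sum fun i _ => ?_)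
    rw [Finset.mul_sum]
    refine (Finset.abs_sum_le_sum_abs _ _).trans (Finset.sum_le_sum fun j _ => ?_)
    rw [abs_div, abs_two]
    have := abs_add_le (boxSum S i j (typeICoeff u) (fun _ => 1))
      (boxSum (insert n S) i j (typeICoeff u) (fun _ => 1))
    linarith
  have hII' : |∑ i ∈ range n, ∑ j ∈ range (n - i),
      (boxSum S i j (typeIICoeffA u B) (typeIICoeffB u) +
        boxSum (insert n S) i j (typeIICoeffA u B) (typeIICoeffB u)) / 2| ≤ (1 / 2) * BII := by
    rw [hBII, Finset.mul_sum]
    refine (Finset.abs_sum_le_sum_abs _ _).trans (Finset.sum_le_sum fun i _ => ?_)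
    rw [Finset.mul_sum]
    refine (Finset.abs_sum_le_sum_abs _ _).trans (Finset.sum_le_sum fun j _ => ?_)
    rw [abs_div, abs_two]
    have := abs_add_le (boxSum S i j (typeIICoeffA u B) (typeIICoeffB u))
      (boxSum (insert n S) i j (typeIICoeffA u B) (typeIICoeffB u))
    linarith
  have hBmul : |(B : ℝ) * ∑ i ∈ range n, ∑ j ∈ range (n - i),
      (boxSum S i j (typeIICoeffA u B) (typeIICoeffB u) +
        boxSum (insert n S) i j (typeIICoeffA u B) (typeIICoeffB u)) / 2| ≤ (B / 2) * BII := by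
    rw [abs_mul, abs_of_pos hB0]
    calc (B : ℝ) * _ ≤ B * ((1 / 2) * BII) := mul_le_mul_of_nonneg_left hII' hB0.le
      _ = B / 2 * BII := by ring
  calc |2 * ∑ m ∈ Ioc 0 N, (moebiusTrunc u : ArithmeticFunction ℝ) m * g m -
        (∑ i ∈ range n, ∑ j ∈ range (n - i),
          (boxSum S i j (typeICoeff u) (fun _ => 1) +
            boxSum (insert n S) i j (typeICoeff u) (fun _ => 1)) / 2) +
        ((B : ℝ) * ∑ i ∈ range n, ∑ j ∈ range (n - i),
          (boxSum S i j (typeIICoeffA u B) (typeIICoeffB u) +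
            boxSum (insert n S) i j (typeIICoeffA u B) (typeIICoeffB u)) / 2 +
          ∑ k ∈ Ioc 0 N, ∑ ℓ ∈ Ioc 0 N,
            (if (σ 0 k : ℝ) ≤ B then 0 else gU u k) * typeIICoeffB u ℓ * g (k * ℓ))|
      ≤ |2 * ∑ m ∈ Ioc 0 N, (moebiusTrunc u : ArithmeticFunction ℝ) m * g m| +
        |∑ i ∈ range n, ∑ j ∈ range (n - i),
          (boxSum S i j (typeICoeff u) (fun _ => 1) +
            boxSum (insert n S) i j (typeICoeff u) (fun _ => 1)) / 2| +
        (|(B : ℝ) * ∑ i ∈ range n, ∑ j ∈ range (n - i),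
          (boxSum S i j (typeIICoeffA u B) (typeIICoeffB u) +
            boxSum (insert n S) i j (typeIICoeffA u B) (typeIICoeffB u)) / 2| +
          |∑ k ∈ Ioc 0 N, ∑ ℓ ∈ Ioc 0 N,
            (if (σ 0 k : ℝ) ≤ B then 0 else gU u k) * typeIICoeffB u ℓ * g (k * ℓ)|) := by
        refine (abs_add_le _ _).trans (add_le_add (abs_sub _ _) (abs_add_le _ _))
    _ ≤ 2 * u + (1 / 2) * BI + ((B / 2) * BII + 2 ^ n * ((n : ℝ) + 1) ^ 4 / B) := by
        refine add_le_add (add_le_add ?_ hI') (add_le_add hBmul herr)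
        rw [abs_mul, abs_two]
        linarith
    _ = 2 * u + (1 / 2) * BI + (B / 2) * BII + 2 ^ n * ((n : ℝ) + 1) ^ 4 / B := by ring

end Literature.NumberTheory.LFunctions.MoebiusWalshVaughan
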